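import Mathlib
import HarnessLib
import HarnessLib.Audit
import Summits.HubbardSuperconductivity.Statement

/-!
Route: CoboundaryCeiling

CLOSED (retired) 2026-08-16T03:16:37Z by planner-rchoice-HubbardSuperconductivity-Cobou-a2bd146e-0 — reason: route-choice (operator hold target-unreachable, 2026-08-16T02:57Z): retired by the rchoice planner — target X=CoboundaryThesis is conceded false at weak coupling and reached by no crux; any glue crux would be X-strength and conceded false;  — note: route-choice (hold 2026-08-16T02:57Z, target-unreachable: CoboundaryThesis): RETIRED, not glued. (1) closes := h_Assembly h_CeilingLemma h_PairGapNonneg h_X: notS is carried entirely by X=CoboundaryThesis; no item implies X (StripeWindowCoboundary = X|box, X->SWC only). (2) Any glue Crux...->X needs. The file is kept as the record of this route; refuted decls are indexed as negative knowledge (`ledger negatives`).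

Route CoboundaryCeiling (negative side; realises idea card condensates-are-cocycles). THESIS X =
CoboundaryThesis, a STATE-FREE
property of the Hamiltonian alone: for every U > 0 and δ ∈ (0,1/2), along the even sides L, the
d-wave pair field
Δ_d = pairField dWaveFormFactor L is an ASYMPTOTIC COBOUNDARY of the Liouvillian shifted by the
finite-volume midpoint pair
chemical potential 2μ̄_L := (E_L(N_L+2) − E_L(N_L−2))/2 (E_L(n) = minEnergyOn of hubbardTorus 2 L 1
U on szSector n 0,
N_L = 2⌊(1−δ)L²/2⌋): for every ε > 0 there is C such that, eventually in even L, some matrix X_L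
with operator norm ≤ C·L²
has ‖Δ_d − [H_L, X_L] − 2μ̄_L X_L‖ ≤ ε·L² (operator norm via Matrix.toEuclideanCLM).
It suffices because of the CEILING LEMMA (crux, provable now): for EVERY normalised (N_L,
S^z=0)-sector ground state ψ_L,
L⁻⁴⟨ψ_L, Δ_d†Δ_d ψ_L⟩ ≤ (‖Δ_d − [H,X] − 2μ̄_L X‖/L²)² + o(1), provided the pair charge gap
E_L(N_L+2)+E_L(N_L−2)−2E_L(N_L)
is asymptotically ≥ 0 (crux PairGapNonneg, also state-free). Mechanism: the GS-to-GS block of Δ_d is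
a (−2μ)-eigenfunctional
of ad_H, so it annihilates coboundaries (Josephson–Anderson phase rotation as a cohomological
constraint); the
Horsch–von der Linden/Koma–Tasaki first moment (tree: LROForcesLowLyingStates_holds) localises the
pair-removed state in an
o(1) spectral window where (ad_H + 2μ̄)X is small. Hence every-GS d-wave order ≤ dist(Δ_d, Ran(ad_H
+ 2μ̄))/L² — a linear,
positivity-free, sign-problem-free ceiling computable at ANY coupling by least-residual problems
over operator densities.
Assembly: CeilingLemma → PairGapNonneg → CoboundaryThesis → ¬HubbardSuperconductivity (glue: NoGo's
exists_groundStateInSector_seq gives an all-sides sector-GS sequence; its even-side LRO sequence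
tends to 0; sum rule
expect_pairField_conjTranspose_mul_holds + not_hubbardSuperconductivity_iff).
Lean (one line, elaborates rc0 in folder/Sketch.lean):
∀ (U δ : ℝ), 0 < U → δ ∈ Set.Ioo (0:ℝ) (1 / 2) → ∀ ε : ℝ, 0 < ε → ∃ C : ℝ, ∀ᶠ k : ℕ in Filter.atTop,
Even (k + 1) → ∃ X : Matrix (Finset (Orb (FermionTorus 2 (k + 1)))) (Finset (Orb (FermionTorus 2 (k
+ 1)))) ℂ, ‖Matrix.toEuclideanCLM (𝕜 := ℂ) X‖ ≤ C * (k + 1) ^ 2 ∧ ‖Matrix.toEuclideanCLM (𝕜 := ℂ)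
(pairField dWaveFormFactor (k + 1) - (hubbardTorus 2 (k + 1) 1 U * X - X * hubbardTorus 2 (k + 1) 1
U) - (((E(N+2) - E(N-2)) / 2 : ℝ) : ℂ) • X)‖ ≤ ε * (k + 1) ^ 2   [E(n) := (hubbardTorus 2 (k+1) 1
U).minEnergyOn (szSector n 0), N := 2 * ⌊(1 - δ) * (k + 1) ^ 2 / 2⌋₊; full names
Literature.MathematicalPhysics.QuantumLattice.*]

Rationale: WHY THIS LINE (catalogue: operator/spectral reformulation + convex/certified computation, NO
physical analogy needed). The summit's order
parameter ⟨Δ_d†Δ_d⟩/L⁴ of a sector ground state ψ has an exact operator-side handle: the GS-to-GS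
block P'(Δ_d)P is a (−2μ_L)-eigen-
functional of ad_H (P'([H,X]+2μ_L X)P = 0 for every X), so the condensate "annihilates
coboundaries"; combined with the Horsch–von der Linden /
Koma–Tasaki first moment [KomaTasaki1994 Thm 2.2 = tree LROForcesLowLyingStates_holds;
HorschVonDerLinden1988; Tasaki2019Tower] it becomes a
quantitative every-GS ceiling m_d ≤ dist(Δ_d, Ran(ad_H + 2μ̄))/L² with NO gap/uniqueness hypothesis.
This route turns that into (i) a
theorem-grade engine (CeilingLemma), (ii) the one state-free hypothesis every first-moment ceiling
in the pool silently needs, filed once as a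
shared item (PairGapNonneg — it is 'H1' of card mott-corner-order-ceiling and the (μ_L−μ_L⁺)₊ term
of eom-resolvent-ceiling), (iii) a certified
census at INTERMEDIATE coupling (the stripe window U≈6–10, δ≈1/10–1/6 of [QinEtAl2020, XuEtAl2024])
where no expansion, RP or QMC certificate
reaches: κ_r(U,μ) = least residual over translation-invariant range-r operator densities is finite
LINEAR algebra (no positivity cone, contrast
the SOS/SDP certificates of route GSCertificate and [WangEtAl2024, FawziFawziScalet2024]), symbolic
in (t,U,μ), sign-problem-free.
Honest scope (found while planning): at WEAK coupling the state-based resolvent bound of card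
eom-resolvent-ceiling (LRO ≤ CU²log²) and at
STRONG coupling the doublon-grading/hole-pair bound of mott-corner-order-ceiling dominate the
state-free coboundary instances (iv),(v) of the
card (operator norms cannot see the hole density); those instances are therefore filed only as
SUPPORT (FreeGasCoboundary, WeakCouplingVanishing).
The formal target X (κ = 0 at every U>0, δ) is, like NoGo's, believed FALSE at weak coupling
(Kohn–Luttinger d-wave order e^{−c/U²} > 0 ⇒
κ ≥ m > 0 by the CeilingLemma itself [RaghuKivelsonScalapino2010, ArovasBergKivelsonRaghu2022]); the
route's value is the engine + the
shared hypothesis + certified every-GS ceilings where numerics say 'no SC', and refuter pressure on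
a STATE-FREE reformulation of ¬S.
RANKED CRUXES. (2) CeilingLemma [crux; provable now, ~800–1500 Lean lines: block/window identity
‖Q_W Δψ‖ ≤ ‖R‖ + width·‖X‖ for the
spectral window Q_W of H around E−2μ̄_L, Markov on the spectral measure of Δψ ⊂ [E_L(N−2),∞) fed by
the double-commutator identity
⟨Δψ,(H−E+2μ̄)Δψ⟩+⟨Δ†ψ,(H−E−2μ̄)Δ†ψ⟩ = ⟨ψ,[Δ†,[H,Δ]]ψ⟩ + 2μ̄⟨[Δ†,Δ]⟩ = O(L²); why it might fail: only
as typed — the window step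
genuinely needs the pair-gap clause (now an explicit hypothesis) and |μ̄_L| = O(1) (provable for
δ∈(0,1/2) by pair-add/remove trial states)].
(3) PairGapNonneg [crux; liminf over even L of E(N_L+2)+E(N_L−2)−2E(N_L) ≥ 0 for all U>0, δ∈(0,1/2);
exact at U=0 (level filling), expected
everywhere (compressible or incompressible phases give ≥ −o(1)); why it might fail:
charge-4e/quartet commensuration (period-4 staggering of
E_L at N ≡ 2 mod 4) or a first-order jump pinned at N_L; a refutation is itself a structural theorem
about pair binding].
(4) StripeWindowCensus [crux, informal until computed: certified rational upper bounds κ_r(U,μ) ≤ κ*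
for r ≤ 3, U ∈ {6,8,10}, μ covering
the a-priori range of μ̄_L at δ ∈ [1/10,1/6]; signature set (explicit finite-range primitive X with
rational coefficients, verified by
norm_num + triangle inequality over local densities) once numbers exist; why it might fail:
bluntness — card kill criterion (a): κ_3 ≥ 0.3·‖Δ_d‖/L²].
SUPPORT: FreeGasCoboundary (U=0, uniform in μ: X_ε = −Σ_k ĝ(k)s(ξ_k/ε)b_k/(2ξ_k), ‖X_ε‖ ≤ (4/ε)L²,
residual ≤ 2·#{k: |ε_k−μ|<ε} ≤ Cεlog(1/ε)L²;
calibration of the census code and the every-free-GS no-pair-LRO theorem incl. degenerate open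
shells); WeakCouplingVanishing (every GS, uniform
in δ: κ ≤ Aεlog(1/ε) + B·U·ε^{−1/2} using ‖[D,X_ε]‖ ≤ 2L²‖χ_ε‖_ℓ², so m_d → 0 as U→0⁺; rate U^{2/3},
dominated by eom-resolvent's U log).
KILL CRITERIA. CeilingLemma refuted as typed and not repairable by restating hypotheses ⇒ close.
PairGapNonneg refuted at some (U,δ) ⇒ the
assembly dies there; restate X with the pair-gap clause regional or close 'refuted'. Census blunt
(κ_3 ≥ 0.3‖Δ_d‖/L² at (8, stripe μ-range) AND at
(2, δ=0.2)) ⇒ close 'exhausted' (engine + PairGapNonneg survive as shared support). Any proof of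
d-wave LRO at some (U₀,δ₀) ⇒ X false ⇒ close.
DELIBERATELY NOT DECOMPOSED: the census computation itself (first tenure action: kit job for κ_r as
an SOCP over range-≤4 densities after
D₄×SU(2)×translation reduction, validated on U=0 where κ=0 is known); the card's instances (i)
η-exactness (tree: etaRaise_commutator_holds),
(ii) A1g slaving (card enslaved-a1g-uniform-eta-twin), (v) Mott grading (mott-corner's route), (vi)
condensate Schrödinger equation;
the Hahn–Banach dual and the BRIDGE conjecture 'non-coboundary ⇒ condensation' (positive side;
likely false dimension-free — 1D test — so it is
NOT load-bearing here); OnlyEtaClimbs (Shiraishi-type classification of local ad_H-eigenoperators in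
d=2, arXiv:1803.02637, 2410.23286).
Prior decls reused: none from reserve/; tree facts used by provers: LROForcesLowLyingStates_holds
(KomaTasakiSSB), hamiltonian_isHermitian_and_
commute_holds, CAR (*_anticommute_holds), expect_pairField_conjTranspose_mul_holds, NoGo's
exists_groundStateInSector_seq / not_hubbardSuperconductivity_iff.
CHEAPEST FALSIFIER. (i) Typing: `lean check` of folder/Sketch.lean (done, rc0) and the restriction
example CoboundaryThesis → StripeWindowCoboundary (done, rc0). (ii) Engine: the U=0, L=4..8 exact
check — for a degenerate open-shell free torus GS verify numerically L⁻⁴⟨Δ_d†Δ_d⟩ ≤ (‖R_θ‖/L² +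
(η+g)C)² + C₃/(ηL²) with the explicit X_θ of FreeGasCoboundary (30-line numpy script; not run in
this one-shot session). (iii) The line: compute κ_1, κ_2 at (U,μ) = (8, −1.5) by the least-residual
LP over range-≤3 densities; κ_2 ≥ 0.3·‖Δ_d‖/L² there AND at (2, μ(δ=0.2)) retires the census use
(card kill criterion (a)). PairGapNonneg: ED of E_L(N±2), E_L(N) on 4×4 at U=8, N=14 (sign of Δ₂) is
a 1-minute sanity check, not a refutation.

Novelty: NEAREST PRIOR ART (searched this session: `lit frontier HubbardSuperconductivity --since 2020`
(hits: arXiv:2410.00810 'Bootstrapping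
Quantum Hamiltonians with Symmetry' PRL 2026; arXiv:2601.18868 'Cooper condensation and pair wave
functions'), `lit bridges --cross any`
(no operator-algebra bridge), `lit search --source s2 "Certifying ground-state properties of
many-body systems"` → arXiv:2310.05844 =
WangEtAl2024 (read pp.1–2: certified bounds on ANY ground-state observable incl. order parameters by
SDP relaxation + variational energy —
needs positivity AND an energy upper bound, finite N, unique GS), `lit search --hybrid` on 'order
parameter / commutator / derivation range'
(no relevant held text), galaxy --star all substring on 'bootstrap Hubbard model', 'Pitaevskii
Stringari uncertainty' (0 rows; galaxyd
saturated for longer phrases); plus the card's own audited searches (refuter-novelty-audit-13: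
Hirschfelder 1960 hypervirial ⟨ψ,[H,X]ψ⟩=0;
KomaTasaki1994 §2.3 (2.18) coboundary vanishing for symmetry generators; Hamiltonian bootstrap
Han–Hartnoll–Kruthoff 2020, Cho et al.
arXiv:2206.12538, FawziFawziScalet2024 = positivity + ⟨[H,O]⟩=0; PitaevskiiStringari1991 state-based
commutator/uncertainty ceilings;
Yang1989 η exact eigenoperator; BachLiebSolovej1994 quasi-free no-pairing; Tian 1997 PLA
on-site/off-site slaving (paywalled acq-01834);
Guarnaccia–Noce 2010 PLA GS correlation upper bounds (paywalled acq-01622)). In-pool neighbours: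
route GSCertificate (SOS/SDP LOWER-boun  [refs: 2410.00810, 2601.18868, 2310.05844, 2206.12538, 1803.02637, 2410.23286, WangEtAl2024, KomaTasaki1994, FawziFawziScalet2024, PitaevskiiStringari1991, Yang1989, BachLiebSolovej1994, HorschVonDerLinden1988, QinEtAl2020, XuEtAl2024, RaghuKivelsonScalapino2010, ArovasBergKivelsonRaghu2022]

Barriers (technique_class: operator-cohomology linear-ceiling first-moment-window): technique_class: operator-cohomology Liouvillian-range-distance first-moment-spectral-window
linear-certificate (no expansion, no RP, no QMC, no quasi-free variational class)
Literature.Barriers.HubbardSuperconductivity.LROForcesLowLyingStates: USED, not evaded — KT Thm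
2.2's first moment (LROForcesLowLyingStates_holds) is the window step of CeilingLemma; the barrier's
content (LRO ⇒ tower, no gap) is exactly why the GS-to-GS block is the right object and why no
gap/uniqueness hypothesis appears; its scope caveat (first moments are one-sided) is why
PairGapNonneg is a separate crux.
Literature.Barriers.HubbardSuperconductivity.PerturbativeInvisibilityOfPairing: APPLIES to the
quantitative reach, not to validity — ceilings are U-power laws at small U (support
WeakCouplingVanishing) and can never locate e^{−c/U²}; the route bounds order from above and does
not claim to decide S at weak coupling (target X is admitted to be believed false there).
Literature.Barriers.HubbardSuperconductivity.WeakCouplingCeiling: not in its class — no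
weak-coupling/RG expansion is summed; the coboundary primitives are explicit operators and the
census works at U = 6–10 where the barrier forbids convergent expansions.
Literature.Barriers.HubbardSuperconductivity.StrongCouplingCeiling: not in its class — no t/U or
polymer expansion; the doublon grading (card instance (v)) is an exact algebraic identity, and it is
deliberately not an item of this route.
Literature.Barriers.HubbardSuperconductivity.Gen

History (route lifecycle, newest last):
- 2026-08-16T03:16:38Z · CLOSED retired — route-choice (operator hold target-unreachable, 2026-08-16T02:57Z): retired by the rchoice planner — target X=CoboundaryThesis is conceded false at weak coupling and reached by no crux; any glue crux (planner-rchoice-HubbardSuperconductivity-Cobou-a2bd146e-0)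

sub-problem: HubbardSuperconductivity · status: closed(retired) · opened planner-plancard-HubbardSuperconductivity-Hub-f4588963-0 2026-08-15T11:03:15Z · rev 2 · ledger route-HubbardSuperconductivity-CoboundaryCeiling
GENERATED by the gate from the ledger (D-0016/17). Provers cite these decls: `theorem foo : Summit.HubbardSuperconductivity.HubbardSuperconductivity.Theses.CoboundaryCeiling.<Decl> := …` in Summits/HubbardSuperconductivity/HubbardSuperconductivity/Theorems/<Name>.lean.
-/

namespace Summit.HubbardSuperconductivity.HubbardSuperconductivity.Theses.CoboundaryCeiling

open scoped BigOperators Topology Manifold Classical MeasureTheory ProbabilityTheory Matrix InnerProductSpace ComplexConjugate ContinuousMap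
open Filter Set Function TopologicalSpace MeasureTheory

attribute [summit_statement] _root_.HubbardSuperconductivity

open Literature.Hubbard

/-- item stmt-HubbardSuperconductivity-2341 · target · rank 0 · closed · moot by None · by planner
why it might fail: Believed FALSE at weak U: Kohn–Luttinger d-wave LRO ~e^{-c/U²} at one (U₀,δ₀) (RaghuKivelsonScalapino2010) gives κ ≥ m > 0 via CeilingLemma+PairGapNonneg; at strong U Sorella2023 Fig.12 has a d-wave SC phase of the PURE model at δ≈0.17–0.25 (U=6–8); ∀U ∀δ is far wider than the stripe box.
sources: RaghuKivelsonScalapino2010, ArovasBergKivelsonRaghu2022 §8.1 p.31, Sorella2023 = arXiv:2101.07045 Fig. 12 (p.12), pp.9–10, QinEtAl2020 = arXiv:1910.08931 §III–IV, KomaTasaki1994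
[target] STATE-FREE thesis X of route CoboundaryCeiling (idea condensates-are-cocycles): for every
U>0, δ∈(0,1/2) and ε>0 there is C such that, eventually along even sides L=k+1, some matrix X with
operator norm ≤ C·L² (‖·‖ of Matrix.toEuclideanCLM) makes the d-wave pair field an ε·L²-approximate
coboundary of the Liouvillian shifted by the finite-volume MIDPOINT pair chemical potential: ‖Δ_d −
[H,X] − 2μ̄_L X‖ ≤ εL², 2μ̄_L := (E_L(N_L+2) − E_L(N_L−2))/2, E_L(n) = minEnergyOn of hubbardTorus 2
L 1 U on szSector n 0, N_L = 2⌊(1−δ)L²/2⌋ (Δ_d = pairField dWaveFormFactor L = √2·Scalapino's Δ_d,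
immaterial). In words: κ(Δ_d;U,δ) := limsup inf_X ‖Δ_d − (ad_H+2μ̄_L)X‖/L² = 0 everywhere. With
CeilingLemma + PairGapNonneg this forces L⁻⁴⟨Δ_d†Δ_d⟩ → 0 for EVERY sector ground-state sequence,
hence ¬S (Assembly). Physics prior: FALSE at weak coupling if Kohn–Luttinger d-wave order exists (S
at (U₀,δ₀) ⇒ κ ≥ m > 0 by CeilingLemma); OPEN at U ≳ 6 where DMRG/AFQMC see stripes and no SC in the
pure t'=0 model (regional crux StripeWindowCoboundary). Dual reading (Hahn–Banach): κ =
sup{|φ(Δ_d-density)| : φ bounded SIGNED translation-invariant functional on charge-(−2) densities,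
φ∘(ad_H+2μ)=0}; ever -/
@[route_item "route-HubbardSuperconductivity-CoboundaryCeiling"]
def CoboundaryThesis : Prop :=
  ∀ (U δ : ℝ), 0 < U → δ ∈ Set.Ioo (0:ℝ) (1 / 2) → ∀ ε : ℝ, 0 < ε → ∃ C : ℝ, ∀ᶠ k : ℕ in Filter.atTop, Even (k + 1) → ∃ X : Matrix (Finset (Literature.MathematicalPhysics.QuantumLattice.Orb (Literature.MathematicalPhysics.QuantumLattice.FermionTorus 2 (k + 1)))) (Finset (Literature.MathematicalPhysics.QuantumLattice.Orb (Literature.MathematicalPhysics.QuantumLattice.FermionTorus 2 (k + 1)))) ℂ, ‖Matrix.toEuclideanCLM (𝕜 := ℂ) X‖ ≤ C * ((k + 1 : ℕ) : ℝ) ^ 2 ∧ ‖Matrix.toEuclideanCLM (𝕜 := ℂ) (Literature.MathematicalPhysics.QuantumLattice.pairField Literature.MathematicalPhysics.QuantumLattice.dWaveFormFactor (k + 1) - (Literature.MathematicalPhysics.QuantumLattice.hubbardTorus 2 (k + 1) 1 U * X - X * Literature.MathematicalPhysics.QuantumLattice.hubbardTorus 2 (k + 1) 1 U) - ((((Literature.MathematicalPhysics.QuantumLattice.hubbardTorus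 2 (k + 1) 1 U).minEnergyOn (Literature.MathematicalPhysics.QuantumLattice.szSector (2 * ⌊(1 - δ) * ((k + 1 : ℕ) : ℝ) ^ 2 / 2⌋₊ + 2) 0) - (Literature.MathematicalPhysics.QuantumLattice.hubbardTorus 2 (k + 1) 1 U).minEnergyOn (Literature.MathematicalPhysics.QuantumLattice.szSector (2 * ⌊(1 - δ) * ((k + 1 : ℕ) : ℝ) ^ 2 / 2⌋₊ - 2) 0)) / 2 : ℝ) : ℂ) • X)‖ ≤ ε * ((k + 1 : ℕ) : ℝ) ^ 2

/-- item stmt-HubbardSuperconductivity-2343 · crux · rank 3 · closed · moot by None · by planner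
why it might fail: No convexity theorem for interacting sector energies at T=0; a charge-4e/quartet (vestigial-PDW) condensate (BergFradkinKivelson2009, Wu–Wang 2024) makes E_L period-4: Δ₂ ≈ −2Δ_4e < 0 whenever N_L ≡ 2 mod 4, i.e. on infinitely many even L ⇒ liminf < 0. Phase separation (ABKR §8.1) costs only o(1).
sources: BergFradkinKivelson2009 = doi:10.1038/nphys1389, doi:10.1038/s41535-024-00674-y (Wu–Wang 2024, d-wave charge-4e SC from fluctuating PDW), ArovasBergKivelsonRaghu2022 = arXiv:2103.12097 §7.1.2 pp.29–30 (PDW close competitor in variational Hubbard studies), §8.1 p.31 (first-order lines, phase separation), Sorella2023 = arXiv:2101.07045 p.9 (phase separation not excluded for δ ≲ 5%), KomaTasaki1994, HubbardSuperconductivity/HubbardSuperconductivity/mott-corner-order-ceiling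
[crux] SHARED STATE-FREE HYPOTHESIS of every first-moment pairing ceiling in the pool (this route's
(h₂); 'H1 / pair-concavity defect κ_L → 0' of card mott-corner-order-ceiling; the '(μ_L − μ_L⁺)₊'
term of card eom-resolvent-ceiling): for every U>0, δ∈(0,1/2) and γ>0, eventually along even sides
L, E_L(N_L+2) + E_L(N_L−2) − 2E_L(N_L) ≥ −γ, E_L(n) := minEnergyOn of hubbardTorus 2 L 1 U on
szSector n 0 (= absolute n-particle ground energy by SU(2)), N_L = 2⌊(1−δ)L²/2⌋. I.e. the
finite-volume PAIR CHARGE GAP at the summit's filling is asymptotically non-negative (no macroscopic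
pair-binding concavity of E_L(·) at N_L). Exact at U=0 (level filling: E(N+2)−E(N) = 2ε_next ≥
2ε_last); at weak U first-order shifts give ≥ −O(U/L²); compressible phases give +4/(χ_c L²),
incompressible ones a positive charge gap, phase separation ≥ −O(L⁻¹)·(interface) → 0. Why it is
needed: with Δ₂ ≤ −g₀ < 0 the pair-removed state Δ_dψ may carry its weight anywhere in [E', E'+|Δ₂|]
and first moments cannot localise it (planner's NOTES, session 1). A proof would upgrade
CeilingLemma, WeakCouplingVanishing and the two neighbouring cards' ceilings to unconditional
every-GS theorems; a refutation (persistent nega -/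
@[route_item "route-HubbardSuperconductivity-CoboundaryCeiling"]
def PairGapNonneg : Prop :=
  ∀ (U δ : ℝ), 0 < U → δ ∈ Set.Ioo (0:ℝ) (1 / 2) → ∀ γ : ℝ, 0 < γ → ∀ᶠ k : ℕ in Filter.atTop, Even (k + 1) → -γ ≤ (Literature.MathematicalPhysics.QuantumLattice.hubbardTorus 2 (k + 1) 1 U).minEnergyOn (Literature.MathematicalPhysics.QuantumLattice.szSector (2 * ⌊(1 - δ) * ((k + 1 : ℕ) : ℝ) ^ 2 / 2⌋₊ + 2) 0) + (Literature.MathematicalPhysics.QuantumLattice.hubbardTorus 2 (k + 1) 1 U).minEnergyOn (Literature.MathematicalPhysics.QuantumLattice.szSector (2 * ⌊(1 - δ) * ((k + 1 : ℕ) : ℝ) ^ 2 / 2⌋₊ - 2) 0) - 2 * (Literature.MathematicalPhysics.QuantumLattice.hubbardTorus 2 (k + 1) 1 U).minEnergyOn (Literature.MathematicalPhysics.QuantumLattice.szSector (2 * ⌊(1 - δ) * ((k + 1 : ℕ) : ℝ) ^ 2 / 2⌋₊) 0)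

/-- item stmt-HubbardSuperconductivity-2344 · crux · rank 4 · closed · moot by None · by planner
why it might fail: Box [6,10]×[1/10,1/6] is wider than the numerics point (8,1/8): Sorella2023 Fig.12 puts a strong-coupling d-wave SC phase of the PURE model at δ∈(0.17,0.24) for U=6, touching the corner (6,1/6); MaierEtAl2005 DCA: d-wave instability. One d-wave-LRO GS sequence in the box ⇒ κ ≥ m > 0 ⇒ false.
sources: QinEtAl2020 = arXiv:1910.08931 §III p.7–8, Fig. 9 p.10, §IV p.11, Sorella2023 = arXiv:2101.07045 Fig. 12 p.12 (transition points δ=19–25.2% U=8, 17–23.9% U=6), p.10, MaierEtAl2005 = arXiv:cond-mat/0504529, XuEtAl2024 = arXiv:2303.08376 p.5, p.7, ArovasBergKivelsonRaghu2022 §6 p.25, §8.1 p.31, Literature.Barriers.HubbardSuperconductivity.PureModelStripeCompetition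
[crux] REGIONAL VERSION OF THE TARGET where numerics say 'no SC': for U ∈ [6,10], δ ∈ [1/10,1/6]
(the pure-model t'=0 stripe window of QinEtAl2020/XuEtAl2024,
Literature.Barriers.HubbardSuperconductivity.PureModelStripeCompetition), the d-wave pair field is
an asymptotic coboundary of ad_H + 2μ̄_L (same clauses as CoboundaryThesis). With CeilingLemma +
PairGapNonneg (regional) this is a THEOREM-GRADE absence of d-wave pair LRO for EVERY sector ground
state in that window — what no expansion (Weak/StrongCouplingCeiling barriers), no RP and no QMC
certificate (SignProblemNPHard) can reach. Work programme (the card's census, first tenure action):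
κ_r(U,μ) := least residual ‖Δ_d − (ad_H+2μ)X‖ per site over translation-invariant charge-(−2)
operator densities X of range ≤ r (a few hundred unknowns after D₄×SU(2)×translation reduction;
residual per-site norm bounded by an SOCP over local blocks), at U ∈ {6,8,10}, μ on a grid covering
the a-priori range of μ̄_L (|μ̄_L| ≤ B provable) with the slack |2μ−2μ̄_L|·‖X‖ absorbed; validated
at U=0 where κ=0 is known (FreeGasCoboundary). Certified small κ_r ⇒ every-GS ceiling m_d ≤ κ_r in
the window even before this crux closes; κ_r → 0 in r is the -/
@[route_item "route-HubbardSuperconductivity-CoboundaryCeiling"]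
def StripeWindowCoboundary : Prop :=
  ∀ U ∈ Set.Icc (6:ℝ) 10, ∀ δ ∈ Set.Icc (1 / 10 : ℝ) (1 / 6), ∀ ε : ℝ, 0 < ε → ∃ C : ℝ, ∀ᶠ k : ℕ in Filter.atTop, Even (k + 1) → ∃ X : Matrix (Finset (Literature.MathematicalPhysics.QuantumLattice.Orb (Literature.MathematicalPhysics.QuantumLattice.FermionTorus 2 (k + 1)))) (Finset (Literature.MathematicalPhysics.QuantumLattice.Orb (Literature.MathematicalPhysics.QuantumLattice.FermionTorus 2 (k + 1)))) ℂ, ‖Matrix.toEuclideanCLM (𝕜 := ℂ) X‖ ≤ C * ((k + 1 : ℕ) : ℝ) ^ 2 ∧ ‖Matrix.toEuclideanCLM (𝕜 := ℂ) (Literature.MathematicalPhysics.QuantumLattice.pairField Literature.MathematicalPhysics.QuantumLattice.dWaveFormFactor (k + 1) - (Literature.MathematicalPhysics.QuantumLattice.hubbardTorus 2 (k + 1) 1 U * X - X * Literature.MathematicalPhysics.QuantumLattice.hubbardTorus 2 (k + 1) 1 U) - ((((Literature.MathematicalPhysics.QuantumLattice.hubbardTorus 2 (k + 1) 1 U).minEnergyOn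 (Literature.MathematicalPhysics.QuantumLattice.szSector (2 * ⌊(1 - δ) * ((k + 1 : ℕ) : ℝ) ^ 2 / 2⌋₊ + 2) 0) - (Literature.MathematicalPhysics.QuantumLattice.hubbardTorus 2 (k + 1) 1 U).minEnergyOn (Literature.MathematicalPhysics.QuantumLattice.szSector (2 * ⌊(1 - δ) * ((k + 1 : ℕ) : ℝ) ^ 2 / 2⌋₊ - 2) 0)) / 2 : ℝ) : ℂ) • X)‖ ≤ ε * ((k + 1 : ℕ) : ℝ) ^ 2

/-- item stmt-HubbardSuperconductivity-2342 · support · rank 2 · closed · moot by None · by planner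
why it might fail: Only as typed: the first-moment window is one-sided, so the lemma needs the pair-gap clause (h2, explicit) and |mu_bar_L| = O(1) (provable for delta in (0,1/2)); a slip in sector bookkeeping (Delta psi in szSector (N-2) 0), even-side/NeZero indexing or the cast of 2mu_bar forces a restate.
sources: KomaTasaki1994 Thm 2.2, HorschVonDerLinden1988, PitaevskiiStringari1991, Tasaki2019Tower, Literature.Barriers.HubbardSuperconductivity.LROForcesLowLyingStates_holds, decl Literature.MathematicalPhysics.QuantumLattice.IsGroundStateInSector (HubbardModel.lean:119-122: eigenvector clause)
[crux] THE ENGINE (every-GS coboundary ceiling; provable now, est. 800–1500 Lean lines). For any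
real U, δ∈(0,1/2), any sequence (N,ψ) satisfying the summit's EVEN-side hypotheses (N_L =
2⌊(1−δ)L²/2⌋, ‖ψ_L‖=1, ψ_L a (N_L,S^z=0)-sector GS of H_L = hubbardTorus 2 L 1 U), assume (h₂): the
pair charge gap Δ₂(L) := E_L(N_L+2)+E_L(N_L−2)−2E_L(N_L) (sector minima, szSector · 0) is ≥ −γ
eventually along even L for every γ>0. Then for every ε>0, C: if eventually (even L) some matrix X
has ‖X‖ ≤ CL² and ‖R‖ ≤ εL², R := Δ − [H,X] − 2μ̄_L X, Δ = pairField dWaveFormFactor L, 2μ̄_L =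
(E_L(N_L+2)−E_L(N_L−2))/2, then for every ε' > ε², eventually (even L) L⁻⁴ Re⟨ψ_L, Δ†Δ ψ_L⟩ ≤ ε'.
PROOF SKETCH (E := E_L(N_L), E' := E_L(N_L−2), E'' := E_L(N_L+2), c := E − 2μ̄, g := max(0,−Δ₂)/2,
M₋ := ‖Δψ‖², M₊ := ‖Δ†ψ‖²): (1) block/window identity — for the spectral projection Q of H onto
[c−g, c+η]: ([H,X]+2μ̄X)ψ = (H−c)Xψ, so ‖QΔψ‖ ≤ ‖QRψ‖ + ‖(H−c)QXψ‖ ≤ ‖R‖ + (η+g)‖X‖ (X arbitrary: no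
sector bookkeeping here); (2) Δψ ∈ szSector (N−2) 0 and H preserves sectors
(hamiltonian_isHermitian_and_commute_holds), so the spectral measure ρ₋ of Δψ lives on [E',∞) = [c +
Δ₂/2, ∞) ⊂ [c−g,∞); Markov: ‖(1−Q)Δψ‖² = ρ₋(c+η,∞) ≤ -/
@[route_item "route-HubbardSuperconductivity-CoboundaryCeiling"]
def CeilingLemma : Prop :=
  ∀ (U δ : ℝ), δ ∈ Set.Ioo (0:ℝ) (1 / 2) → ∀ (N : ℕ → ℕ) (ψ : ∀ L, Literature.MathematicalPhysics.QuantumLattice.Fock (Literature.MathematicalPhysics.QuantumLattice.Orb (Literature.MathematicalPhysics.QuantumLattice.FermionTorus 2 L))), (∀ L, Even L → N L = 2 * ⌊(1 - δ) * (L : ℝ) ^ 2 / 2⌋₊ ∧ star (ψ L) ⬝ᵥ ψ L = 1 ∧ Literature.MathematicalPhysics.QuantumLattice.IsGroundStateInSector (Literature.MathematicalPhysics.QuantumLattice.hubbardTorus 2 L 1 U) (N L) 0 (ψ L)) → (∀ γ : ℝ, 0 < γ → ∀ᶠ k : ℕ in Filter.atTop, Even (k + 1) → -γ ≤ (Literature.MathematicalPhysics.QuantumLattice.hubbardTorus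 2 (k + 1) 1 U).minEnergyOn (Literature.MathematicalPhysics.QuantumLattice.szSector (N (k + 1) + 2) 0) + (Literature.MathematicalPhysics.QuantumLattice.hubbardTorus 2 (k + 1) 1 U).minEnergyOn (Literature.MathematicalPhysics.QuantumLattice.szSector (N (k + 1) - 2) 0) - 2 * (Literature.MathematicalPhysics.QuantumLattice.hubbardTorus 2 (k + 1) 1 U).minEnergyOn (Literature.MathematicalPhysics.QuantumLattice.szSector (N (k + 1)) 0)) → ∀ ε C : ℝ, 0 < ε → (∀ᶠ k : ℕ in Filter.atTop, Even (k + 1) → ∃ X : Matrix (Finset (Literature.MathematicalPhysics.QuantumLattice.Orb (Literature.MathematicalPhysics.QuantumLattice.FermionTorus 2 (k + 1)))) (Finset (Literature.MathematicalPhysics.QuantumLattice.Orb (Literature.MathematicalPhysics.QuantumLattice.FermionTorus 2 (k + 1)))) ℂ, ‖Matrix.toEuclideanCLM (𝕜 := ℂ) X‖ ≤ C * ((k + 1 : ℕ) : ℝ) ^ 2 ∧ ‖Matrix.toEuclideanCLM (𝕜 := ℂ) (Literature.MathematicalPhysics.QuantumLattice.pairField Literature.MathematicalPhysics.QuantumLattice.dWaveFormFactor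 (k + 1) - (Literature.MathematicalPhysics.QuantumLattice.hubbardTorus 2 (k + 1) 1 U * X - X * Literature.MathematicalPhysics.QuantumLattice.hubbardTorus 2 (k + 1) 1 U) - ((((Literature.MathematicalPhysics.QuantumLattice.hubbardTorus 2 (k + 1) 1 U).minEnergyOn (Literature.MathematicalPhysics.QuantumLattice.szSector (N (k + 1) + 2) 0) - (Literature.MathematicalPhysics.QuantumLattice.hubbardTorus 2 (k + 1) 1 U).minEnergyOn (Literature.MathematicalPhysics.QuantumLattice.szSector (N (k + 1) - 2) 0)) / 2 : ℝ) : ℂ) • X)‖ ≤ ε * ((k + 1 : ℕ) : ℝ) ^ 2) → ∀ ε' : ℝ, ε ^ 2 < ε' → ∀ᶠ k : ℕ in Filter.atTop, Even (k + 1) → (Literature.MathematicalPhysics.QuantumLattice.expect ((Literature.MathematicalPhysics.QuantumLattice.pairField Literature.MathematicalPhysics.QuantumLattice.dWaveFormFactor (k + 1))ᴴ * Literature.MathematicalPhysics.QuantumLattice.pairField Literature.MathematicalPhysics.QuantumLattice.dWaveFormFactor (k + 1)) (ψ (k + 1))).re / ((k + 1 : ℕ) : ℝ) ^ 4 ≤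 ε'

/-- item stmt-HubbardSuperconductivity-2345 · support · rank 9 · closed · moot by None · by planner
sources: BachLiebSolovej1994, KomaTasaki1994
[support] CALIBRATION / U=0 INSTANCE (provable now): for every ε>0 there are C, L₀ such that for all
sides L ≥ L₀ (all L, not only even) and EVERY μ ∈ ℝ some X with ‖X‖ ≤ C L² has ‖Δ_d − [T,X] − 2μX‖ ≤
εL², T = hubbardTorus 2 L 1 0. Construction: pair modes b_k := c_{k↑}c_{−k↓} are EXACT cocycles,
(ad_T + 2μ)b_k = −2ξ_k b_k (ξ_k = ε_k − μ, ε_k = −2(cos k₁+cos k₂)), and Δ_d = √2 Σ_k ĝ_d(k) b_k,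
ĝ_d = 2(cos k₁ − cos k₂); take X_θ := −√2 Σ_k ĝ_d(k) s(ξ_k/θ) b_k/(2ξ_k) with a cut-off s ≡ 1 off
|ξ| ≥ θ, ≡ 0 on |ξ| ≤ θ/2: ‖X_θ‖ ≤ (4√2/θ)·L² uniformly in μ (‖b_k‖ ≤ 1), residual = shell part,
‖R_θ‖ ≤ 4√2·#{k ∈ (2π/L)ℤ_L² : |ε_k − μ| < θ} ≤ (A θ log(1/θ) + A'/L) L² uniformly in μ
(square-lattice DOS has only the log singularity at 0; lattice-point count = area + O(perimeter/L)).
Consequences: κ(Δ_g; 0, μ) = 0 in every channel, hence (CeilingLemma, h₂ exact at U=0) NO pair LRO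
in ANY free-fermion sector ground state, including the entangled superpositions inside degenerate
open shells invisible to Wick/BLS — the non-variational cousin of BachLiebSolovej1994 Thm 2.11; and
the U=0 validation point of the census code. || Sources: BachLiebSolovej1994, Yang1989 (exact
eigenoperators), KomaTasaki1 -/
@[route_item "route-HubbardSuperconductivity-CoboundaryCeiling"]
def FreeGasCoboundary : Prop :=
  ∀ ε : ℝ, 0 < ε → ∃ C : ℝ, ∃ L₀ : ℕ, ∀ L : ℕ, L₀ ≤ L → ∀ μ : ℝ, ∃ X : Matrix (Finset (Literature.MathematicalPhysics.QuantumLattice.Orb (Literature.MathematicalPhysics.QuantumLattice.FermionTorus 2 (L + 1)))) (Finset (Literature.MathematicalPhysics.QuantumLattice.Orb (Literature.MathematicalPhysics.QuantumLattice.FermionTorus 2 (L + 1)))) ℂ, ‖Matrix.toEuclideanCLM (𝕜 := ℂ) X‖ ≤ C * ((L + 1 : ℕ) : ℝ) ^ 2 ∧ ‖Matrix.toEuclideanCLM (𝕜 := ℂ) (Literature.MathematicalPhysics.QuantumLattice.pairField Literature.MathematicalPhysics.QuantumLattice.dWaveFormFactor (L + 1) - (Literature.MathematicalPhysics.QuantumLattice.hubbardTorus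 2 (L + 1) 1 0 * X - X * Literature.MathematicalPhysics.QuantumLattice.hubbardTorus 2 (L + 1) 1 0) - ((2 * μ : ℝ) : ℂ) • X)‖ ≤ ε * ((L + 1 : ℕ) : ℝ) ^ 2

/-- item stmt-HubbardSuperconductivity-2346 · support · rank 9 · closed · moot by None · by planner
sources: RaghuKivelsonScalapino2010, BachLiebSolovej1994, HubbardSuperconductivity/HubbardSuperconductivity/eom-resolvent-ceiling
[support] WEAK-COUPLING INSTANCE (iv) in robust form (provable after CeilingLemma): for every θ>0
there is U₀>0 such that for all U∈(0,U₀), ALL δ∈(0,1/2) and every even-side sector-GS sequence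
satisfying (h₂), eventually L⁻⁴Re⟨Δ_d†Δ_d⟩ ≤ θ — every-GS d-wave order vanishes as U→0⁺ UNIFORMLY in
the doping. Coboundary proof: with X_θ' from FreeGasCoboundary at μ = μ̄_L, (ad_{T+UD} + 2μ̄)X = Δ_d
− R − U[D,X] and [D, Σ_{x,y}K(x,y)c_{x↑}c_{y↓}] = −Σ K(x,y)(n_{y↑}c_{x↑}c_{y↓} +
c_{x↑}c_{y↓}n_{x↓}), so ‖[D,X]‖ ≤ 2L²·sup_y‖K(·,y)‖_ℓ² = 2L²‖χ‖_ℓ² ≤ B L² θ'^{−1/2}(log) uniformly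
in μ (‖Σ_x f(x)c_x‖ = ‖f‖_ℓ²); κ ≤ Aθ'log(1/θ') + B U θ'^{−1/2} ⇒ κ ≲ U^{2/3} (m_d² ≲ U^{4/3})
uniformly in μ hence in δ; |μ̄_L| ≤ B(δ) uniform on (0,1/2) is not even needed. NOTE (planner):
dominated at weak coupling by the state-based resolvent bound of card eom-resolvent-ceiling (LRO ≤
CU²log²(1/U), also every GS, same (h₂)-type input); filed here as the coboundary calculus' own
calibration and because no ITEM states the uniform-in-δ vanishing yet (dedup will attach other
routes). Any S-proof at weak coupling must produce order below this ceiling (consistent with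
e^{−c/U²}). || Sources: RaghuKivelsonScalapino2010, -/
@[route_item "route-HubbardSuperconductivity-CoboundaryCeiling"]
def WeakCouplingVanishing : Prop :=
  ∀ θ : ℝ, 0 < θ → ∃ U₀ : ℝ, 0 < U₀ ∧ ∀ U ∈ Set.Ioo (0:ℝ) U₀, ∀ δ ∈ Set.Ioo (0:ℝ) (1 / 2), ∀ (N : ℕ → ℕ) (ψ : ∀ L, Literature.MathematicalPhysics.QuantumLattice.Fock (Literature.MathematicalPhysics.QuantumLattice.Orb (Literature.MathematicalPhysics.QuantumLattice.FermionTorus 2 L))), (∀ L, Even L → N L = 2 * ⌊(1 - δ) * (L : ℝ) ^ 2 / 2⌋₊ ∧ star (ψ L) ⬝ᵥ ψ L = 1 ∧ Literature.MathematicalPhysics.QuantumLattice.IsGroundStateInSector (Literature.MathematicalPhysics.QuantumLattice.hubbardTorus 2 L 1 U) (N L) 0 (ψ L)) → (∀ γ : ℝ, 0 < γ → ∀ᶠ k : ℕ in Filter.atTop, Even (k + 1) → -γ ≤ (Literature.MathematicalPhysics.QuantumLattice.hubbardTorus 2 (k + 1) 1 U).minEnergyOn (Literature.MathematicalPhysics.QuantumLattice.szSector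 (N (k + 1) + 2) 0) + (Literature.MathematicalPhysics.QuantumLattice.hubbardTorus 2 (k + 1) 1 U).minEnergyOn (Literature.MathematicalPhysics.QuantumLattice.szSector (N (k + 1) - 2) 0) - 2 * (Literature.MathematicalPhysics.QuantumLattice.hubbardTorus 2 (k + 1) 1 U).minEnergyOn (Literature.MathematicalPhysics.QuantumLattice.szSector (N (k + 1)) 0)) → ∀ᶠ k : ℕ in Filter.atTop, Even (k + 1) → (Literature.MathematicalPhysics.QuantumLattice.expect ((Literature.MathematicalPhysics.QuantumLattice.pairField Literature.MathematicalPhysics.QuantumLattice.dWaveFormFactor (k + 1))ᴴ * Literature.MathematicalPhysics.QuantumLattice.pairField Literature.MathematicalPhysics.QuantumLattice.dWaveFormFactor (k + 1)) (ψ (k + 1))).re / ((k + 1 : ℕ) : ℝ) ^ 4 ≤ θ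

/-- item stmt-HubbardSuperconductivity-2347 · assembly · rank 1 · closed · moot by None · by planner
sources: Scalapino1995, KomaTasaki1994
[assembly] CeilingLemma → PairGapNonneg → CoboundaryThesis → ¬HubbardSuperconductivity. Glue
(provable as soon as stated; ~150 lines): fix U>0, δ∈(0,1/2);
Summit.HubbardSuperconductivity.NoGo.exists_groundStateInSector_seq (Theorems/NoGoNogoThesis.lean)
gives an all-sides normalised (N_L,0)-sector GS sequence (N,ψ) of hubbardTorus 2 L 1 U (a fortiori
the even-side hypotheses); PairGapNonneg gives (h₂) for it (rewrite N (k+1) = 2⌊(1−δ)(k+1)²/2⌋);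
CoboundaryThesis gives, for each ε>0, C and the eventual primitives; CeilingLemma ⇒ ∀ε'>ε²:
eventually (even L) L⁻⁴Re⟨Δ†Δ⟩ ≤ ε', so the even-side sequence → 0; by the sum rule
expect_pairField_conjTranspose_mul_holds and torusProj_bijOn_halfOpenBox, (2k)⁻⁴ Σ_{x,y∈halfOpenBox
2 (2k)} torusPullback (pairFieldCorr dWaveFormFactor ψ) (2k) x y → 0, hence its liminf is 0 and
¬HasLongRangeOrder; conclude with
Summit.HubbardSuperconductivity.NoGo.not_hubbardSuperconductivity_iff (or _of_allSides). || Sources: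
Scalapino1995 §2 (2.4); KomaTasaki1994. -/
@[route_item "route-HubbardSuperconductivity-CoboundaryCeiling"]
def Assembly : Prop :=
  CeilingLemma → PairGapNonneg → CoboundaryThesis → ¬ HubbardSuperconductivity

end Summit.HubbardSuperconductivity.HubbardSuperconductivity.Theses.CoboundaryCeiling
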